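import Summits.BirchSwinnertonDyer.Rank1Residual.X5.SelmerSolitaireQuadraticParityFlip
import HarnessLib

/-!
# X5 · Selmer solitaire, quadratic layer — Q7 (part 2): QS3 `parityLaw_holds`, the PARITY / TYPE
# LAW `type(n) + |n| = const` on the core vertices of a totally singular Lagrangian

HONEST FRAMING (cell `b2b-bsdres`, run/shared/lean/b2b/bsd-rank1-residual/, verbatim in every
file): the goal of the cell is to DELETE the COMBINATION-SHAPED residual classes of the
Birch–Swinnerton-Dyer formula for ALL analytic-rank `≤ 1` elliptic curves over `ℚ` — "full BSD
formula for every rank `≤ 1` curve in class `C`" assembled STRICTLY from published theorems — so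
that the rank-`≤ 1` remainder becomes exactly the CONSTRUCTION-SHAPED classes, which are TYPED
(missing-input `Prop`s), NOT attempted. This is not "finishing BSD". O1 team (class X5, `p = 2`,
non-CM), ORDER v2.9 pool slot (ii‴) = lens-2 GEN 10's QUADRATIC-SPACE LAYER (o1 lead R-G20.3 /
R-G20.4, PLAN C150), item **Q7** (optional, QS3); pool hand = seat `b2b-bsdres-x11b3-p3` GEN 8 (x11b3
prover released to the o1 pool; yields to x11b3 deals). PURE `𝔽₂` LINEAR ALGEBRA about the
vocabulary of `X5/SelmerSolitaireQuadratic.lean` (x11b3-p4, p283641; spelling of record = lens-2's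
seat sketch `HOME/b2b-bsdres-o1-idea-2-g10/lean/O1Stub1QuadraticSketch.lean`): THEOREMS ONLY (no
definition, no named fact, no `sorry`); nothing arithmetic is asserted (the dictionary AR1–AR4 to
Selmer groups is NOT here); reach-neutral (R1 closes no class; QS3 is "a law, not load-bearing",
lens-2 2G10.2); nothing booked; O1 OPEN.

## What is proved

* §3 `Parity.finrank_add_card_invariant`: for the family `Λ n = Λ_n^{w}` of coordinate Lagrangians
  (membership `x ∈ Λ n ↔ (x none).2 = 0 ∧ InLam n x`), `dim (U ∩ Λ n) + |n| ≡ dim (U ∩ Λ ∅) (mod 2)`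
  for every `n` — `Finset` induction, one vertex at a time, by the flip lemma of part 1
  (`X5/SelmerSolitaireQuadraticParityFlip.lean`).
* §4 at a CORE vertex `n` with generator `x` of `U ∩ Λ_n` (a line, Q5's `Cube.eq_of_inLam`):
  `dim (U ∩ Λ_n^{w}) = 1` if `x_∞ = w` and `= 0` if `x_∞ = w′`.
* §5 **`parityLaw_holds : ParityLaw`** — Q1's word-shape QS3 VERBATIM: there is `c ∈ 𝔽₂` (namely
  `dim (U ∩ Λ_∅^{w}) + 1`) with `x_∞ = lineOf b` and `[b] + |n| = c` at every core vertex `n`. The law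
  holds for EVERY totally singular Lagrangian, whether or not its core set is connected in the
  cube; it is the `𝔽₂`-shadow of the two families of Lagrangians of `Q_D` (lens-2's TYPE bit = the
  family of the coordinate Lagrangian `Λ_n^{type(n)}` meeting `U` in a line). Not load-bearing for
  R1 (lens-2 2G10.2); exec-verified by lens-2 GEN 10 (`qs_layer_check.py`).

References: lens-2 GEN 5 (G5.3 T1) and GEN 10 (2G10.2 QS3), `cells/o1/ROUTES-O1.md`; B. Poonen,
E. Rains, JAMS 25 (2012) §2 [cite: PoonenRains2012, §2]; B. Mazur, K. Rubin, Contemp. Math. 358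
(2004), Def. 4.2 [cite: MazurRubin2004Intro, Def. 4.2]. Folklore linear algebra.

## Tree search (dedup, 2026-08-21)
`lean search 'parityLaw_holds|Quadratic.Parity'` → part 1 only; reserved name `parityLaw_holds`
proposed in INBOX l.5307 (cc-typer-4 countersign by silence).
-/

namespace Summit.BirchSwinnertonDyer.Rank1Residual.X5.SelmerSolitaire.Quadratic

open Finset SelmerSolitaire

variable {s : ℕ}

namespace Parity

/-! ### §3 The invariant `dim (U ∩ Λ_n^{w}) + |n| (mod 2)` -/

/-- **Parity invariance**: for the family `Λ n = Λ_n^{w}` of coordinate Lagrangians,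
`dim (U ∩ Λ n) + |n| ≡ dim (U ∩ Λ ∅) (mod 2)` for every `n` (induction on `n`, one vertex at a time,
by the flip lemma). This is the `𝔽₂`-shadow of the two families of maximal totally singular
subspaces of the split quadratic space `Q_D`. [folklore] -/
theorem finrank_add_card_invariant {U : Submodule (ZMod 2) (QVec s)} (hU : IsTSLagrangian U)
    (Λ : Finset (Fin s) → Submodule (ZMod 2) (QVec s))
    (hΛ : ∀ n x, x ∈ Λ n ↔ (x none).2 = 0 ∧ InLam n x) (n : Finset (Fin s)) :
    (Module.finrank (ZMod 2) ↥(U ⊓ Λ n) : ZMod 2) + n.card = Module.finrank (ZMod 2) ↥(U ⊓ Λ ∅) := by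
  classical
  induction n using Finset.induction_on with
  | empty => simp
  | insert l n hl ih =>
    have h2 : (2 : ZMod 2) = 0 := by decide
    rw [Finset.card_insert_of_notMem hl, ← ih, finrank_flip_zmod2 hU hl (Λ n) (Λ (insert l n)) (hΛ n)
      (hΛ (insert l n)), Nat.cast_add, Nat.cast_one]
    linear_combination h2

/-! ### §4 At a core vertex: `dim (U ∩ Λ_n^{w}) = [type(n) = w]` -/

/-- At a CORE vertex `n` with generator `x` of `U ∩ Λ_n` of type `w` (`x_∞ = (1,0)`),
`U ∩ Λ_n^{w} = ⟨x⟩` has dimension `1`. (Q5's line lemma `Cube.eq_of_inLam`.) [folklore] -/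
theorem finrank_eq_one_of_type_false {U : Submodule (ZMod 2) (QVec s)} (hU : IsTSLagrangian U)
    {n : Finset (Fin s)} (hn : CoreQ U n) (Λ₁ : Submodule (ZMod 2) (QVec s))
    (h₁ : ∀ x, x ∈ Λ₁ ↔ (x none).2 = 0 ∧ InLam n x) {x : QVec s} (hx : x ∈ U) (hxn : InLam n x)
    (hx0 : x ≠ 0) (hxb : x none = lineOf false) : Module.finrank (ZMod 2) ↥(U ⊓ Λ₁) = 1 := by
  have heq : U ⊓ Λ₁ = (ZMod 2 ∙ x) := by
    apply le_antisymm
    · rintro y ⟨hyU, hyΛ⟩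
      by_cases hy0 : y = 0
      · rw [hy0]; exact Submodule.zero_mem _
      · rw [Cube.eq_of_inLam hU.1 hn hyU hx ((h₁ y).mp hyΛ).2 hxn hy0 hx0]
        exact Submodule.mem_span_singleton_self x
    · rw [Submodule.span_singleton_le_iff_mem]
      exact ⟨hx, (h₁ x).mpr ⟨by rw [hxb]; rfl, hxn⟩⟩
  rw [heq, finrank_span_singleton hx0]

/-- At a CORE vertex `n` whose generator has type `w′` (`x_∞ = (0,1)`), `U ∩ Λ_n^{w} = 0`. [folklore] -/
theorem finrank_eq_zero_of_type_true {U : Submodule (ZMod 2) (QVec s)} (hU : IsTSLagrangian U)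
    {n : Finset (Fin s)} (hn : CoreQ U n) (Λ₁ : Submodule (ZMod 2) (QVec s))
    (h₁ : ∀ x, x ∈ Λ₁ ↔ (x none).2 = 0 ∧ InLam n x) {x : QVec s} (hx : x ∈ U) (hxn : InLam n x)
    (hx0 : x ≠ 0) (hxb : x none = lineOf true) : Module.finrank (ZMod 2) ↥(U ⊓ Λ₁) = 0 := by
  have heq : U ⊓ Λ₁ = ⊥ := by
    refine (Submodule.eq_bot_iff _).mpr ?_
    rintro y ⟨hyU, hyΛ⟩
    by_contra hy0
    have hyx := Cube.eq_of_inLam hU.1 hn hyU hx ((h₁ y).mp hyΛ).2 hxn hy0 hx0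
    have h2 := ((h₁ y).mp hyΛ).1
    rw [hyx, hxb] at h2
    exact one_ne_zero h2
  rw [heq, finrank_bot]

end Parity

/-! ### §5 QS3 -/

/-- **QS3 (PARITY / TYPE LAW, T1), proved** — Q1's word-shape `ParityLaw` verbatim: for a totally
singular Lagrangian `U` there is a constant `c ∈ 𝔽₂` such that at every CORE vertex `n` the
generator `x` of `U ∩ Λ_n` has `∞`-part `w` or `w′` — `x_∞ = lineOf b` — and `[b] + |n| = c`.
Proof: `c := dim (U ∩ Λ_∅^{w}) + 1`; by the parity invariance (§3) `dim (U ∩ Λ_n^{w}) + |n|` is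
constant, and at a core vertex `dim (U ∩ Λ_n^{w}) = [b = w] = [b] + 1` (§4). Not load-bearing for
R1 (lens-2); it is the shadow of the two families of Lagrangians of `Q_D`. (lens-2 G5.3 T1;
exec-verified.) [folklore] -/
theorem parityLaw_holds : ParityLaw := by
  classical
  intro s U hU
  -- the coordinate Lagrangians `Λ_n^{w}`
  obtain ⟨Λ, hΛ⟩ : ∃ Λ : Finset (Fin s) → Submodule (ZMod 2) (QVec s),
      ∀ n x, x ∈ Λ n ↔ (x none).2 = 0 ∧ InLam n x :=
    ⟨fun n ↦
      { carrier := {x | (x none).2 = 0 ∧ InLam n x}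
        add_mem' := fun {x y} hx hy ↦
          ⟨by rw [Pi.add_apply, Prod.snd_add, hx.1, hy.1, add_zero], Cube.inLam_add hx.2 hy.2⟩
        zero_mem' := ⟨rfl, fun _ ↦ ⟨fun _ ↦ rfl, fun _ ↦ rfl⟩⟩
        smul_mem' := fun c {x} hx ↦
          ⟨by rw [Pi.smul_apply, Prod.smul_snd, smul_eq_mul, hx.1, mul_zero], fun i ↦
            ⟨fun hi ↦ by rw [Pi.smul_apply, Prod.smul_fst, smul_eq_mul, (hx.2 i).1 hi, mul_zero],
             fun hi ↦ by rw [Pi.smul_apply, Prod.smul_snd, smul_eq_mul, (hx.2 i).2 hi, mul_zero]⟩⟩ },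
      fun _ _ ↦ Iff.rfl⟩
  refine ⟨(Module.finrank (ZMod 2) ↥(U ⊓ Λ ∅) : ZMod 2) + 1, fun n x hn hx hxn hx0 ↦ ?_⟩
  -- the `∞`-part of the generator is `w` or `w′`
  have hxinf : x none ≠ 0 := Cube.apply_none_ne_zero hn hx hxn hx0
  have hqx : (x none).1 * (x none).2 = 0 := by rw [← Cube.qform_eq_of_inLam hxn]; exact hU.1 x hx
  obtain ⟨b, hb⟩ := NF.exists_eq_lineOf_of_fst_add_snd (Parity.fst_add_snd_eq_one _ hxinf hqx)
  refine ⟨b, hb, ?_⟩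
  have hinv := Parity.finrank_add_card_invariant hU Λ hΛ n
  have h2 : (2 : ZMod 2) = 0 := by decide
  cases b with
  | false =>
    rw [Parity.finrank_eq_one_of_type_false hU hn (Λ n) (hΛ n) hx hxn hx0 hb, Nat.cast_one] at hinv
    rw [← hinv]
    simp only [Bool.false_eq_true, ↓reduceIte]
    linear_combination -h2
  | true =>
    rw [Parity.finrank_eq_zero_of_type_true hU hn (Λ n) (hΛ n) hx hxn hx0 hb, Nat.cast_zero] at hinv
    rw [← hinv]
    simp only [↓reduceIte]
    ring

end Summit.BirchSwinnertonDyer.Rank1Residual.X5.SelmerSolitaire.Quadratic
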